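import Summits.Ventures.HodgeRepro2.T5SU11SphericalTransformKernelComp

/-!
# Summary XXX — the spherical transform of the decaying solution, of the kernel and of the composed kernels
(rows 628–630), under uniform names

Throughout `μ = λ(λ − 2)`, `μ′ = λ′(λ′ − 2)`, `K_λ` the kernel of `G^I_λ`, `K_λ^{∘(k+1)}(t, s) = (G^I_λ)ᵏ K_λ(·, s)(t)` the composed
kernels, `χ_λ` the decaying solution, `Ξ = φ_1`.

* `decay_transform`, `decay_transform'`, `decay_transform_ground`, `decay_transform_pos` — **`∫_0^∞ χ_λ φ_{λ′} sinh 2s ds = 1/(μ − μ′)`**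
  for `1 < λ′ < λ` and for `2 − λ < λ′ < 1`; `∫ χ_λ Ξ sinh 2s ds = 1/(λ − 1)²` (rows 628–629);
* `iterate_sph`, `iterate_sph'`, `kernel_transform'` — **`(G^I_λ)ⁿ φ_{λ′} = φ_{λ′}/(μ′ − μ)ⁿ`; the kernel's row transform in the reflected
  range** (row 629; the range `1 < λ′ < λ` of the row transform is row 519's `integral_kernel_mul_sph`);
* `kernel_comp_transform_fst`, `kernel_comp_transform` — **`∫ K_λ^{∘(k+1)}(t, s) φ_{λ′}(a_s) sinh 2s ds = φ_{λ′}(a_t)/(μ′ − μ)^{k+1}`**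
  (row 630).

Nothing is claimed about (N).

Blind lane: Mathlib + the HodgeRepro2 prefix only; no sorry; axioms ⊆ {propext, Classical.choice,
Quot.sound}.
-/

namespace Summit.Ventures.HodgeRepro2.T5SU11RadialSummaryXXX

open Filter Topology MeasureTheory
open Set (Ioi Ioc)
open T5SU11Cartan T5SU11SphericalFunction T5SU11SphericalDecay T5SU11RadialGreenKernel T5SU11RadialGreenImproper
  T5SU11SphericalTransformDecay T5SU11SphericalTransformKernel T5SU11SphericalTransformKernelComp

section measure

variable [MeasurableSpace Circle] [BorelSpace Circle]

variable {lam : ℝ} (hlam : 1 < lam)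

include hlam in
/-- **`∫_0^∞ χ_λ(s) φ_{λ′}(a_s) sinh 2s ds = 1/(μ − μ′)`** for `1 < λ′ < λ` (row 628). -/
theorem decay_transform {lam' : ℝ} (h1 : 1 < lam') (h2 : lam' < lam) :
    ∫ s in Ioi 0, sphDecay lam s * sph lam' (hyp s) * Real.sinh (2 * s)
      = 1 / (lam * (lam - 2) - lam' * (lam' - 2)) :=
  integral_sphDecay_mul_sph_eq hlam h1 h2

include hlam in
/-- **`∫_0^∞ χ_λ(s) φ_{λ′}(a_s) sinh 2s ds = 1/(μ − μ′)`** for `2 − λ < λ′ < 1` (row 629). -/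
theorem decay_transform' {lam' : ℝ} (h1 : 2 - lam < lam') (h2 : lam' < 1) :
    ∫ s in Ioi 0, sphDecay lam s * sph lam' (hyp s) * Real.sinh (2 * s)
      = 1 / (lam * (lam - 2) - lam' * (lam' - 2)) :=
  integral_sphDecay_mul_sph_eq' hlam h1 h2

include hlam in
/-- **`∫_0^∞ χ_λ(s) Ξ(s) sinh 2s ds = 1/(λ − 1)²`** (row 628). -/
theorem decay_transform_ground :
    ∫ s in Ioi 0, sphDecay lam s * sph 1 (hyp s) * Real.sinh (2 * s) = 1 / (lam - 1) ^ 2 :=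
  integral_sphDecay_mul_sph_one_eq hlam

include hlam in
/-- The transform of `χ_λ` is positive (row 628). -/
theorem decay_transform_pos {lam' : ℝ} (h1 : 1 < lam') (h2 : lam' < lam) :
    0 < ∫ s in Ioi 0, sphDecay lam s * sph lam' (hyp s) * Real.sinh (2 * s) :=
  integral_sphDecay_mul_sph_pos hlam h1 h2

include hlam in
/-- **`(G^I_λ)ⁿ φ_{λ′} = φ_{λ′}/(μ′ − μ)ⁿ`** for `1 < λ′ < λ` (row 629). -/
theorem iterate_sph {lam' : ℝ} (h1 : 1 < lam') (h2 : lam' < lam) (n : ℕ) {t : ℝ} (ht : 0 < t) :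
    ((greenSolI (fun t => sph lam (hyp t)) (sphDecay lam))^[n] (fun s => sph lam' (hyp s))) t
      = (1 / (lam' * (lam' - 2) - lam * (lam - 2))) ^ n * sph lam' (hyp t) :=
  iterate_sph_eq hlam h1 h2 n t ht

include hlam in
/-- **`(G^I_λ)ⁿ φ_{λ′} = φ_{λ′}/(μ′ − μ)ⁿ`** for `2 − λ < λ′ < 1` (row 629). -/
theorem iterate_sph' {lam' : ℝ} (h1 : 2 - lam < lam') (h2 : lam' < 1) (n : ℕ) {t : ℝ} (ht : 0 < t) :
    ((greenSolI (fun t => sph lam (hyp t)) (sphDecay lam))^[n] (fun s => sph lam' (hyp s))) t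
      = (1 / (lam' * (lam' - 2) - lam * (lam - 2))) ^ n * sph lam' (hyp t) :=
  iterate_sph_eq' hlam h1 h2 n t ht

include hlam in
/-- **The kernel's row transform in the reflected range** `2 − λ < λ′ < 1` (row 629). -/
theorem kernel_transform' {lam' : ℝ} (h1 : 2 - lam < lam') (h2 : lam' < 1) {t : ℝ} (ht : 0 < t) :
    ∫ s in Ioi 0, sphGreenKernel lam t s * sph lam' (hyp s) * Real.sinh (2 * s)
      = sph lam' (hyp t) / (lam' * (lam' - 2) - lam * (lam - 2)) :=
  integral_kernel_mul_sph_eq' hlam h1 h2 ht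

include hlam in
/-- **The composed kernels' transform in the first variable** (row 630). -/
theorem kernel_comp_transform_fst {lam' : ℝ} (h1 : 1 < lam') (h2 : lam' < lam) {s : ℝ} (hs : 0 < s) (k : ℕ) :
    ∫ t in Ioi 0, ((greenSolI (fun t => sph lam (hyp t)) (sphDecay lam))^[k] (fun r => sphGreenKernel lam r s)) t
        * sph lam' (hyp t) * Real.sinh (2 * t)
      = (1 / (lam' * (lam' - 2) - lam * (lam - 2))) ^ (k + 1) * sph lam' (hyp s) :=
  integral_kernel_comp_mul_sph_fst hlam h1 h2 hs k

include hlam in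
/-- **`∫ K_λ^{∘(k+1)}(t, s) φ_{λ′}(a_s) sinh 2s ds = φ_{λ′}(a_t)/(μ′ − μ)^{k+1}`** (row 630). -/
theorem kernel_comp_transform {lam' : ℝ} (h1 : 1 < lam') (h2 : lam' < lam) {t : ℝ} (ht : 0 < t) (k : ℕ) :
    ∫ s in Ioi 0, ((greenSolI (fun t => sph lam (hyp t)) (sphDecay lam))^[k] (fun u => sphGreenKernel lam u s)) t
        * sph lam' (hyp s) * Real.sinh (2 * s)
      = (1 / (lam' * (lam' - 2) - lam * (lam - 2))) ^ (k + 1) * sph lam' (hyp t) :=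
  integral_kernel_comp_mul_sph hlam h1 h2 ht k

end measure

end Summit.Ventures.HodgeRepro2.T5SU11RadialSummaryXXX
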